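import Mathlib.RepresentationTheory.Homological.GroupCohomology.LowDegree
import Mathlib.LinearAlgebra.BilinearForm.Properties
import Mathlib.LinearAlgebra.Dual.Lemmas
import Literature.AlgebraicGeometry.HodgeTheory.LocallyTrivialExtensionClasses
import Summits.HodgeConjecture.HodgeConjecture.Theorems.LinearSystemTorelliLocalTubeSpanFrame
import Summits.HodgeConjecture.HodgeConjecture.Theorems.LinearSystemTorelliLocalTubeSpanNCNodal
import Summits.HodgeConjecture.HodgeConjecture.Theorems.LinearSystemTorelliLocalTubeSpanReduction

/-!
# Route LinearSystemTorelli — crux `LocalTubeSpan`: the abelian tail at mixed points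

Helper file (`--supports stmt-HodgeConjecture-2490`, line `Sketch`, stub `stub_abelianTail`, the
cycle-3 hardest stub, taken by the line lead).  At a MIXED point `s₀` of the discriminant — a
one-branch (Janssen-complete) cluster of local vanishing cycles together with transversal nodes
whose cycles are tied to the cluster by global relations (tacnode + node: `δ₁ + δ₃ + δ₄ = 0`) — the
local monodromy group `G` is generated by `s₁ ∪ s₂`: the cluster's meridians `s₁` and the node
meridians `s₂`, all acting by Picard–Lefschetz transvections `t(x) = x - B(x, e_t) e_t` of the
(nondegenerate, alternating) intersection form, the node cycles `e_t`, `t ∈ s₂`, being non-zero and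
orthogonal to every cycle (so the node meridians are central).  The frame mechanism (files
`…Frame`, `…FrameMod`, `…FramePartial`) kills an undetected cocycle on `s₁` up to a coboundary;
this file proves that the remaining cocycle is a coboundary:

* `localTubeSpan_H1π_eq_zero_of_abelianTail` — if an undetected cocycle vanishes on `s₁`, it is a
  coboundary, PROVIDED every non-zero `ℓ` lying both in `L₁ = ℚ e(s₁)` and in `ℚ e(s₂)` (a relation
  tying node cycles to the cluster) admits JANSSEN COMPANIONS: elements `g₁, g₂ ∈ ⟨s₁⟩` acting as
  transvections along `a` and `a + cℓ` (`a ∈ L₁`, `c ≠ 0`) — supplied in the geometric situation by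
  W. Janssen, *Skew-symmetric vanishing lattices and their monodromy groups*, Math. Ann. 266 (1983)
  Thm. 2.9 (`δ + 2β ∈ Δ` for `δ ∈ Δ` and `β` in the radical of the lattice `ℤΔ`).

Proof (the lead's).  Write `φ(t) = a_t e_t` for `t ∈ s₂`.  For every relation
`y + Σ c_t e_t = 0` (`y ∈ L₁`) one has `Σ c_t a_t = 0`: with `ℓ = Σ c_t e_t`, the subgroup
generated by `g₁, g₂` and the nodes involved acts by COMMUTING transvections along the mutually
orthogonal non-zero cycles `a, a + cℓ, e_t`, so by the normal-crossing nodal lemma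
(`localTubeSpan_injective_evalCoinv_of_orthogonal_transvections`) the undetected `φ` is a
coboundary `dx_H` there; `φ(g₁) = φ(g₂) = 0` give `B(x_H, a) = B(x_H, a + cℓ) = 0`, hence
`B(x_H, ℓ) = 0`, while `a_t = -B(x_H, e_t)`; summing, `Σ c_t a_t = -B(x_H, ℓ) = 0` (for `ℓ = 0` the
nodes alone suffice).  Hence a linear functional `F` with `F|L₁ = 0`, `F(e_t) = -a_t` exists;
`F = B(x, ·)` by nondegeneracy, and `dx` agrees with `φ` on every generator, so `φ = dx`.
No named facts (the companions are a hypothesis); everything over `ℚ`.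
-/

-- `Summit.HodgeConjecture.HodgeConjecture.Theorems` is the mandated namespace (single-conjunct summit:
-- Sub = Summit), which `linter.dupNamespace` flags on every declaration; the lakefile turns the
-- linter off tree-wide (weak option), restated here so stand-alone elaboration is warning-free too.
set_option linter.dupNamespace false

noncomputable section

open CategoryTheory groupCohomology
open Literature.AlgebraicGeometry.HodgeTheory

namespace Summit.HodgeConjecture.HodgeConjecture.Theorems

section AbelianTail

variable {G : Type} [Group G] (A : Rep.{0} ℚ G)

/-- Generators of a subgroup, viewed inside it, generate it: for a family `g : ι → G`, the family
`i ↦ ⟨g i, _⟩` generates `Subgroup.closure (Set.range g)` as a group. [folklore] -/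
theorem localTubeSpan_closure_range_inclusion_eq_top {ι : Type} (g : ι → G) :
    Subgroup.closure (Set.range fun i => (⟨g i, Subgroup.subset_closure ⟨i, rfl⟩⟩ :
      Subgroup.closure (Set.range g))) = ⊤ := by
  set H := Subgroup.closure (Set.range g) with hH
  apply Subgroup.map_injective H.subtype_injective
  rw [MonoidHom.map_closure, ← MonoidHom.range_eq_map, Subgroup.range_subtype]
  congr 1
  ext x
  simp only [Set.mem_image, Set.mem_range, Subgroup.coe_subtype]
  constructor
  · rintro ⟨_, ⟨i, rfl⟩, rfl⟩; exact ⟨i, rfl⟩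
  · rintro ⟨i, rfl⟩; exact ⟨_, ⟨i, rfl⟩, rfl⟩

/-- **The NC lemma on a finite commuting sub-configuration.**  If finitely many elements `g_i` of
`G` act on the finite-dimensional `ℚ`-space `A` (nondegenerate `B`) as transvections along mutually
orthogonal non-zero cycles `d_i`, then every cocycle undetected by all elements of `G` is a
coboundary on the `g_i`: `φ(g_i) = g_i·x - x` for one vector `x` (the normal-crossing nodal lemma
applied to the subgroup they generate). [folklore] -/
theorem localTubeSpan_exists_sub_eq_of_orthogonal_family [FiniteDimensional ℚ A.V]
    (B : LinearMap.BilinForm ℚ A.V) (hB : B.Nondegenerate) {n : ℕ} (g : Fin n → G)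
    (d : Fin n → A.V) (hd : ∀ i, d i ≠ 0)
    (hPL : ∀ (i : Fin n) (x : A.V), A.ρ (g i) x = x - B x (d i) • d i)
    (horth : ∀ i j, B (d i) (d j) = 0)
    (φ : cocycles₁ A) (hφ : ∀ g : G, (φ : G → A.V) g ∈ subOneRange A g) :
    ∃ x : A.V, ∀ i, (φ : G → A.V) (g i) = A.ρ (g i) x - x := by
  set H : Subgroup G := Subgroup.closure (Set.range g) with hH
  let t : Fin n → H := fun i => ⟨g i, Subgroup.subset_closure ⟨i, rfl⟩⟩
  have ht : Subgroup.closure (Set.range t) = ⊤ := localTubeSpan_closure_range_inclusion_eq_top g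
  have hinj : Function.Injective (evalCoinv (Rep.res H.subtype A)) :=
    localTubeSpan_injective_evalCoinv_of_orthogonal_transvections (Rep.res H.subtype A) B hB t ht d
      hd (fun i x => by rw [Rep.coe_res_obj_ρ']; exact hPL i x) horth
  obtain ⟨x, hx⟩ := localTubeSpan_exists_sub_eq_of_injective_evalCoinv_res A H hinj φ
    (fun g _ => hφ g)
  exact ⟨x, fun i => (hx (g i) (Subgroup.subset_closure ⟨i, rfl⟩)).symm⟩

/-- **The abelian tail at a mixed point of the discriminant** (stub `stub_abelianTail` of line
`Sketch`).  Let `G = ⟨s₁ ∪ s₂⟩` act on the finite-dimensional `ℚ`-space `V = A` through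
Picard–Lefschetz transvections `t(x) = x - B(x, e_t)e_t` of a nondegenerate alternating form `B`,
the node cycles `e_t`, `t ∈ s₂`, being non-zero and orthogonal to every cycle.  Assume JANSSEN
COMPANIONS: for every non-zero `ℓ ∈ ℚe(s₁) ∩ ℚe(s₂)` there are `g₁, g₂ ∈ ⟨s₁⟩` acting as
transvections along some `a ∈ ℚe(s₁)`, `a ≠ 0`, and along `a + cℓ ≠ 0`, `c ≠ 0` (Janssen 1983,
Thm. 2.9, for a complete orbit).  Then every cocycle undetected by all elements of `G` which
vanishes on `s₁` is a coboundary. [cite: Schnell2010, §7 Prop. 12 (proof)] -/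
theorem localTubeSpan_H1π_eq_zero_of_abelianTail [FiniteDimensional ℚ A.V]
    (B : LinearMap.BilinForm ℚ A.V) (hB : B.Nondegenerate) (hBalt : B.IsAlt)
    (s₁ s₂ : Set G) (hs : Subgroup.closure (s₁ ∪ s₂) = ⊤) (e : G → A.V)
    (hPL : ∀ t ∈ s₁ ∪ s₂, ∀ x : A.V, A.ρ t x = x - B x (e t) • e t)
    (horth : ∀ t ∈ s₂, ∀ t' ∈ s₁ ∪ s₂, B (e t) (e t') = 0) (hne : ∀ t ∈ s₂, e t ≠ 0)
    (hcomp : ∀ ℓ ∈ Submodule.span ℚ (e '' s₁) ⊓ Submodule.span ℚ (e '' s₂), ℓ ≠ 0 →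
      ∃ g₁ ∈ Subgroup.closure s₁, ∃ g₂ ∈ Subgroup.closure s₁, ∃ (a : A.V) (c : ℚ),
        a ≠ 0 ∧ a + c • ℓ ≠ 0 ∧ c ≠ 0 ∧ a ∈ Submodule.span ℚ (e '' s₁) ∧
        (∀ x : A.V, A.ρ g₁ x = x - B x a • a) ∧
        (∀ x : A.V, A.ρ g₂ x = x - B x (a + c • ℓ) • (a + c • ℓ)))
    (φ : cocycles₁ A) (hφ : ∀ g : G, (φ : G → A.V) g ∈ subOneRange A g)
    (hφ₁ : ∀ t ∈ s₁, (φ : G → A.V) t = 0) :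
    H1π A φ = 0 := by
  classical
  set L₁ : Submodule ℚ A.V := Submodule.span ℚ (e '' s₁) with hL₁
  set L₂ : Submodule ℚ A.V := Submodule.span ℚ (e '' s₂) with hL₂
  -- alternating ⇒ antisymmetric, and node cycles are orthogonal to everything on both sides
  have hanti : ∀ x y : A.V, B x y = -B y x := fun x y => (hBalt.neg_eq y x).symm
  have horthL₁ : ∀ t ∈ s₂, ∀ y ∈ L₁, B (e t) y = 0 ∧ B y (e t) = 0 := by
    intro t ht y hy
    have h1 : B (e t) y = 0 := by
      refine Submodule.span_induction (fun x hx => ?_) (by simp) (fun x y _ _ hx hy => ?_)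
        (fun c x _ hx => ?_) hy
      · obtain ⟨t', ht', rfl⟩ := hx
        exact horth t ht t' (Or.inl ht')
      · rw [map_add, hx, hy, add_zero]
      · rw [map_smul, hx, smul_zero]
    exact ⟨h1, by rw [hanti, h1, neg_zero]⟩
  have horthL₂ : ∀ t ∈ s₂, ∀ y ∈ L₂, B (e t) y = 0 ∧ B y (e t) = 0 := by
    intro t ht y hy
    have h1 : B (e t) y = 0 := by
      refine Submodule.span_induction (fun x hx => ?_) (by simp) (fun x y _ _ hx hy => ?_)
        (fun c x _ hx => ?_) hy
      · obtain ⟨t', ht', rfl⟩ := hx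
        exact horth t ht t' (Or.inr ht')
      · rw [map_add, hx, hy, add_zero]
      · rw [map_smul, hx, smul_zero]
    exact ⟨h1, by rw [hanti, h1, neg_zero]⟩
  -- `φ` vanishes on `⟨s₁⟩`
  have hφ₁' : ∀ g ∈ Subgroup.closure s₁, (φ : G → A.V) g = 0 := fun g hg =>
    localTubeSpan_cocycles₁_apply_eq_zero_of_mem_closure A φ s₁ hφ₁ hg
  -- Step 0: `φ(t) = a_t e_t` on the nodes
  have hex : ∀ t ∈ s₂, ∃ c : ℚ, (φ : G → A.V) t = c • e t := fun t ht => by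
    obtain ⟨w, hw⟩ := hφ t
    refine ⟨-B w (e t), ?_⟩
    rw [← hw, LinearMap.sub_apply, LinearMap.id_apply, hPL t (Or.inr ht), neg_smul]
    abel
  choose! a ha using hex
  -- Step 1: consistency — every relation `y + Σ c_t e_t = 0`, `y ∈ L₁`, has `Σ c_t a_t = 0`
  have hcons : ∀ (c : ↥s₂ →₀ ℚ) (y : A.V), y ∈ L₁ →
      y + c.sum (fun t q => q • e t) = 0 → c.sum (fun t q => q * a t) = 0 := by
    intro c y hy hrel
    set ℓ : A.V := c.sum (fun t q => q • e t) with hℓ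
    have hℓL₂ : ℓ ∈ L₂ := by
      refine Submodule.sum_mem _ fun t _ => Submodule.smul_mem _ _ ?_
      exact Submodule.subset_span ⟨t, t.2, rfl⟩
    have hℓL₁ : ℓ ∈ L₁ := by
      have : ℓ = -y := eq_neg_of_add_eq_zero_right hrel
      rw [this]
      exact L₁.neg_mem hy
    -- the node part of the configuration, indexed by `Fin`
    set F : Finset ↥s₂ := c.support with hF
    let ν : Fin F.card → ↥s₂ := fun i => F.equivFin.symm i
    have hνmem : ∀ i, ν i ∈ F := fun i => (F.equivFin.symm i).2
    -- from `B(x_H, ℓ) = 0` and `a_t = -B(x_H, e_t)` on the support, conclude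
    have hfinish : ∀ xH : A.V, B xH ℓ = 0 →
        (∀ i : Fin F.card, (φ : G → A.V) (ν i) = A.ρ (ν i : G) xH - xH) →
        c.sum (fun t q => q * a t) = 0 := by
      intro xH hxℓ hxν
      have hat : ∀ t ∈ F, a t = -B xH (e t) := fun t htF => by
        have h1 := hxν (F.equivFin ⟨t, htF⟩)
        have hνt : ν (F.equivFin ⟨t, htF⟩) = t := by
          simp only [ν, Equiv.symm_apply_apply]
        rw [hνt, ha t t.2, hPL t (Or.inr t.2), sub_sub_cancel_left] at h1
        have h2 : (a t + B xH (e t)) • e (t : G) = 0 := by rw [add_smul, h1, neg_add_cancel]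
        rcases smul_eq_zero.1 h2 with h3 | h3
        · linarith [h3]
        · exact absurd h3 (hne t t.2)
      have e1 : c.sum (fun t q => q * a t) = -B xH ℓ := by
        rw [hℓ]
        simp only [Finsupp.sum, map_sum, map_smul, smul_eq_mul, ← Finset.sum_neg_distrib]
        refine Finset.sum_congr rfl fun t htF => ?_
        rw [hat t htF]
        ring
      rw [e1, hxℓ, neg_zero]
    by_cases hℓ0 : ℓ = 0
    · -- the nodes alone: NC lemma on `⟨supp c⟩`
      obtain ⟨xH, hxH⟩ := localTubeSpan_exists_sub_eq_of_orthogonal_family A B hB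
        (fun i => (ν i : G)) (fun i => e (ν i)) (fun i => hne _ (ν i).2)
        (fun i x => hPL _ (Or.inr (ν i).2) x)
        (fun i j => (horthL₂ _ (ν i).2 _ (Submodule.subset_span ⟨_, (ν j).2, rfl⟩)).1) φ hφ
      exact hfinish xH (by rw [hℓ0, map_zero]) hxH
    · -- companions `g₁, g₂` and the nodes: NC lemma on `⟨g₁, g₂, supp c⟩`
      obtain ⟨g₁, hg₁, g₂, hg₂, a₀, c₀, ha₀, ha₀ℓ, hc₀, ha₀L₁, hg₁T, hg₂T⟩ :=
        hcomp ℓ ⟨hℓL₁, hℓL₂⟩ hℓ0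
      -- the configuration `a₀, a₀ + c₀ℓ, e_{ν i}`
      let gfam : Fin (F.card + 2) → G := Fin.cons g₁ (Fin.cons g₂ fun i => (ν i : G))
      let dfam : Fin (F.card + 2) → A.V := Fin.cons a₀ (Fin.cons (a₀ + c₀ • ℓ) fun i => e (ν i))
      have hB_a₀_ℓ : B a₀ ℓ = 0 := by
        rw [hℓ]
        simp only [Finsupp.sum, map_sum, map_smul, smul_eq_mul]
        refine Finset.sum_eq_zero fun t _ => ?_
        rw [(horthL₁ _ t.2 a₀ ha₀L₁).2, mul_zero]
      have hB_ℓ_ℓ : B ℓ ℓ = 0 := hBalt ℓ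
      have hB_e_a₀ : ∀ t : ↥s₂, B (e t) a₀ = 0 ∧ B a₀ (e t) = 0 := fun t =>
        horthL₁ _ t.2 a₀ ha₀L₁
      have hB_e_ℓ : ∀ t : ↥s₂, B (e t) ℓ = 0 ∧ B ℓ (e t) = 0 := fun t => horthL₂ _ t.2 ℓ hℓL₂
      have hdfam : ∀ i, dfam i ≠ 0 := by
        refine Fin.cases ha₀ (Fin.cases ha₀ℓ fun i => ?_)
        exact hne _ (ν i).2
      have hPLfam : ∀ (i : Fin (F.card + 2)) (x : A.V), A.ρ (gfam i) x = x - B x (dfam i) • dfam i := by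
        refine Fin.cases hg₁T (Fin.cases hg₂T fun i x => ?_)
        exact hPL _ (Or.inr (ν i).2) x
      have horthfam : ∀ i j, B (dfam i) (dfam j) = 0 := by
        have h00 : B a₀ a₀ = 0 := hBalt a₀
        have h01 : B a₀ (a₀ + c₀ • ℓ) = 0 := by rw [map_add, map_smul, h00, hB_a₀_ℓ]; simp
        have h10 : B (a₀ + c₀ • ℓ) a₀ = 0 := by rw [hanti, h01, neg_zero]
        have h11 : B (a₀ + c₀ • ℓ) (a₀ + c₀ • ℓ) = 0 := hBalt _
        refine Fin.cases ?_ (Fin.cases ?_ fun i => ?_)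
        · refine Fin.cases h00 (Fin.cases h01 fun j => ?_)
          exact (hB_e_a₀ (ν j)).2
        · refine Fin.cases h10 (Fin.cases h11 fun j => ?_)
          change B (a₀ + c₀ • ℓ) (e (ν j)) = 0
          rw [LinearMap.BilinForm.add_left, LinearMap.BilinForm.smul_left, (hB_e_a₀ (ν j)).2,
            (hB_e_ℓ (ν j)).2]
          simp
        · refine Fin.cases (hB_e_a₀ (ν i)).1 (Fin.cases ?_ fun j => ?_)
          · change B (e (ν i)) (a₀ + c₀ • ℓ) = 0
            rw [map_add, map_smul, (hB_e_a₀ (ν i)).1, (hB_e_ℓ (ν i)).1]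
            simp
          · exact (horthL₂ _ (ν i).2 _ (Submodule.subset_span ⟨_, (ν j).2, rfl⟩)).1
      obtain ⟨xH, hxH⟩ := localTubeSpan_exists_sub_eq_of_orthogonal_family A B hB gfam dfam hdfam
        hPLfam horthfam φ hφ
      -- read off `B(x_H, a₀) = 0`, `B(x_H, a₀ + c₀ℓ) = 0`
      have hx1 : B xH a₀ = 0 := by
        have h1 := hxH 0
        change (φ : G → A.V) g₁ = A.ρ g₁ xH - xH at h1
        rw [hφ₁' g₁ hg₁, hg₁T, sub_sub_cancel_left, eq_comm, neg_eq_zero, smul_eq_zero] at h1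
        exact h1.resolve_right ha₀
      have hx2 : B xH (a₀ + c₀ • ℓ) = 0 := by
        have h1 := hxH 1
        change (φ : G → A.V) g₂ = A.ρ g₂ xH - xH at h1
        rw [hφ₁' g₂ hg₂, hg₂T, sub_sub_cancel_left, eq_comm, neg_eq_zero, smul_eq_zero] at h1
        exact h1.resolve_right ha₀ℓ
      have hxℓ : B xH ℓ = 0 := by
        rw [map_add, map_smul, hx1, zero_add, smul_eq_mul, mul_eq_zero] at hx2
        exact hx2.resolve_left hc₀
      exact hfinish xH hxℓ fun i => hxH i.succ.succ
  -- Step 2: a linear functional `F` with `F|L₁ = 0` and `F(e_t) = -a_t` on the nodes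
  obtain ⟨F, hF₁, hF₂⟩ : ∃ F : Module.Dual ℚ A.V, (∀ y ∈ L₁, F y = 0) ∧
      ∀ t ∈ s₂, F (e t) = -a t := by
    -- parametrise `W = L₁ + ℚe(s₂)` by `(↥s₂ →₀ ℚ) × L₁`
    let Φ : ((↥s₂ →₀ ℚ) × ↥L₁) →ₗ[ℚ] A.V :=
      (Finsupp.linearCombination ℚ fun t : ↥s₂ => e t).coprod L₁.subtype
    let Λ : ((↥s₂ →₀ ℚ) × ↥L₁) →ₗ[ℚ] ℚ :=
      (Finsupp.linearCombination ℚ fun t : ↥s₂ => -a t).coprod 0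
    have hΦ : ∀ z, Φ z = z.1.sum (fun t q => q • e t) + z.2 := fun z => by
      change Finsupp.linearCombination ℚ (fun t : ↥s₂ => e t) z.1 + L₁.subtype z.2 = _
      rw [Finsupp.linearCombination_apply]
      rfl
    have hΛ : ∀ z, Λ z = z.1.sum (fun t q => q * -a t) := fun z => by
      change Finsupp.linearCombination ℚ (fun t : ↥s₂ => -a t) z.1 + (0 : ↥L₁ →ₗ[ℚ] ℚ) z.2 = _
      rw [Finsupp.linearCombination_apply, LinearMap.zero_apply, add_zero]
      rfl
    have hker : LinearMap.ker Φ ≤ LinearMap.ker Λ := by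
      intro z hz
      rw [LinearMap.mem_ker] at hz ⊢
      rw [hΦ] at hz
      rw [hΛ]
      have h1 := hcons z.1 z.2 z.2.2 (by rw [add_comm]; exact hz)
      have e1 : z.1.sum (fun t q => q * -a t) = -z.1.sum (fun t q => q * a t) := by
        simp only [Finsupp.sum, mul_neg, Finset.sum_neg_distrib]
      rw [e1, h1, neg_zero]
    let f₀ : LinearMap.range Φ →ₗ[ℚ] ℚ :=
      (LinearMap.ker Φ).liftQ Λ hker ∘ₗ (Φ.quotKerEquivRange).symm.toLinearMap
    have hf₀ : ∀ z, f₀ ⟨Φ z, LinearMap.mem_range_self Φ z⟩ = Λ z := fun z => by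
      change (LinearMap.ker Φ).liftQ Λ hker ((Φ.quotKerEquivRange).symm ⟨Φ z, _⟩) = Λ z
      rw [LinearMap.quotKerEquivRange_symm_apply_image Φ z (LinearMap.mem_range_self Φ z)]
      rfl
    refine ⟨Subspace.dualLift (LinearMap.range Φ) f₀, fun y hy => ?_, fun t ht => ?_⟩
    · have e1 : y = Φ (0, ⟨y, hy⟩) := by rw [hΦ]; simp
      have hmem : y ∈ LinearMap.range Φ := ⟨_, e1.symm⟩
      rw [Subspace.dualLift_of_mem hmem]
      have : (⟨y, hmem⟩ : LinearMap.range Φ) = ⟨Φ (0, ⟨y, hy⟩), LinearMap.mem_range_self Φ _⟩ :=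
        Subtype.ext e1
      rw [this, hf₀, hΛ]
      simp
    · have e1 : e t = Φ (Finsupp.single ⟨t, ht⟩ 1, 0) := by
        rw [hΦ]; simp
      have hmem : e t ∈ LinearMap.range Φ := ⟨_, e1.symm⟩
      rw [Subspace.dualLift_of_mem hmem]
      have : (⟨e t, hmem⟩ : LinearMap.range Φ) =
          ⟨Φ (Finsupp.single ⟨t, ht⟩ 1, 0), LinearMap.mem_range_self Φ _⟩ := Subtype.ext e1
      rw [this, hf₀, hΛ]
      simp
  -- Step 3: `F = B(x, ·)`; `dx` agrees with `φ` on every generator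
  obtain ⟨x, hx⟩ : ∃ x : A.V, ∀ y, B x y = F y :=
    ⟨(B.toDual hB).symm F, fun y => LinearMap.BilinForm.apply_toDual_symm_apply F y⟩
  obtain ⟨ψ, hψapply⟩ : ∃ ψ : cocycles₁ A,
      ∀ g, (ψ : G → A.V) g = (φ : G → A.V) g - (A.ρ g x - x) :=
    ⟨φ - ⟨d₀₁ A x, d₀₁_apply_mem_cocycles₁ x⟩, fun g => by
      change (φ : G → A.V) g - d₀₁ A x g = _
      rw [d₀₁_hom_apply]⟩
  have hgen : ∀ t ∈ s₁ ∪ s₂, (ψ : G → A.V) t = 0 := by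
    rintro t (ht | ht)
    · rw [hψapply, hφ₁ t ht, hPL t (Or.inl ht), hx,
        hF₁ (e t) (Submodule.subset_span ⟨t, ht, rfl⟩)]
      simp
    · rw [hψapply, ha t ht, hPL t (Or.inr ht), hx, hF₂ t ht, sub_sub_cancel_left, neg_smul, neg_neg,
        sub_self]
  -- Step 4: `ψ` vanishes on `⟨s₁ ∪ s₂⟩ = G`, so `φ = dx`
  have hall : ∀ g, (ψ : G → A.V) g = 0 := fun g =>
    localTubeSpan_cocycles₁_apply_eq_zero_of_mem_closure A ψ (s₁ ∪ s₂) hgen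
      (by rw [hs]; exact Subgroup.mem_top g)
  rw [H1π_eq_zero_iff, mem_coboundaries₁_iff_exists]
  refine ⟨x, fun g => ?_⟩
  have := hall g
  rw [hψapply, sub_eq_zero] at this
  exact this.symm

end AbelianTail

end Summit.HodgeConjecture.HodgeConjecture.Theorems

end
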